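import Literature.AnabelianGeometry.EtaleTheta.Discharge.Sec2DiscreteNormalizersBridge
import Literature.AnabelianGeometry.EtaleTheta.Discharge.Sec2DiscreteNormalizersTemperedFI
import Literature.AnabelianGeometry.SemiGraphs.FreeFactorOfFiniteIndex

/-!
# [EtTh] Lemma 2.17 (i) "Discrete Normalizers" — unconditional; (ii) modulo the tempered-π₁ input

Mochizuki, *The Étale Theta Function and its Frobenioid-theoretic Manifestations* [EtTh],
Publ. RIMS 45 (2009), §2, Lemma 2.17, PRIMS text pp.58–59 (printed pp.284–285; bib key
`MochizukiEtTh2009`):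

> "(i) Let `F` be a group that contains a normal subgroup of finite index `G ⊆ F` such that `G` is
> a free discrete group of finite rank; `H ⊆ F` a subgroup such that the group `H ⋂ G` is
> nonabelian. Write `F̂, Ĝ` for the profinite completions of `F, G`. Then `N_{F̂}(H) = N_F(H)`."

PROOF-ONLY (no definitions).  All three printed inputs of the proof of (i) are theorems of the tree:
(a) [SemiAnbd] Cor. 1.6 (ii) = `SemiGraphs.corollary_1_6_ii_holds` (M. Hall's free-factor theorem,
abc-iut-L5-t16), (b) P. Stebe's conjugacy separability = `FreeGroup.conjugacySeparable`
(abc-iut-L5-t14), (c) centralizers of free generators in the profinite completion =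
`ProfiniteCompletion.centralizer_eta_basis_le_closure_zpowers` (abc-iut-L5-d2).  Hence Lemma 2.17 (i),
i.e. the typed statement `ThetaCovers.TemperedCoverData.Lem217_i` (abc-iut-L2-t2), HOLDS
(`lem217_i`, `TemperedCoverData.Lem217_i_holds`), and Lemma 2.17 (ii) (`T.Lem217_ii`) holds modulo
only the tempered-fundamental-group inputs `IsTempered T.Gtp` + the tower fact `htower`
(`TemperedCoverData.Lem217_ii_of_tower`; finite-index form with the `H`-independent `htower₀`:
`normalizer_map_toHat_eq_of_finiteIndex`).

Honest framing: classical combinatorial / profinite group theory; nothing here concerns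
[IUTchIII] Cor. 3.12.
-/

namespace Literature.AnabelianGeometry.EtaleTheta

open CategoryTheory ProfiniteGrp ProfiniteGrp.ProfiniteCompletion Topology
open Literature.AnabelianGeometry.SemiGraphs

universe u

namespace DiscreteNormalizers

/-- **[EtTh] Lemma 2.17 (i) (Discrete Normalizers)**, unconditionally, in the typed shape of
`ThetaCovers.TemperedCoverData.Lem217_i`: for `F ⊇ G` with `G` normal of finite index and free of
finite rank, and `H ≤ F` with `H ∩ G` non-abelian, `N_{F̂}(η H) = η(N_F(H))` in the profinite
completion `η : F → F̂`. [cite: MochizukiEtTh2009, Lem 2.17(i) pp.58–59] -/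
theorem lem217_i :
    ∀ (F : Type u) [Group F] (G H : Subgroup F) [IsFreeGroup G], G.Normal → G.FiniteIndex →
      Finite (IsFreeGroup.Generators G) → (∃ a ∈ H ⊓ G, ∃ b ∈ H ⊓ G, a * b ≠ b * a) →
      let η : F →* ProfiniteGrp.ProfiniteCompletion.completion (GrpCat.of F) :=
        (ProfiniteGrp.ProfiniteCompletion.eta (GrpCat.of F)).hom
      Subgroup.normalizer ((H.map η : Subgroup _) : Set _) =
        (Subgroup.normalizer (H : Set F)).map η :=
  lem217_i_of_hall corollary_1_6_ii_holds

end DiscreteNormalizers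

namespace ThetaCovers.TemperedCoverData

open DiscreteNormalizers

/-- **[EtTh] Lemma 2.17 (i)** as typed by abc-iut-L2-t2 (`Lem217_i`) — HOLDS.
[cite: MochizukiEtTh2009, Lem 2.17(i) pp.58–59] -/
theorem Lem217_i_holds : Lem217_i.{u} :=
  lem217_i

/-- **[EtTh] Lemma 2.17 (ii)** as typed (`T.Lem217_ii`), for `T : TemperedCoverData l`, modulo only the
tempered-fundamental-group inputs: `Π^tp_C` is tempered (`hT`, [SemiAnbd] Def. 3.1 (i)) and the
anabelian tower fact `htower` ("quotients of `Π` by characteristic open subgroups of `Π`, which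
contain finite rank free normal subgroups of finite index", p.59, meeting `H/N` non-abelianly).
[cite: MochizukiEtTh2009, Lem 2.17(ii) pp.58–59] -/
theorem Lem217_ii_of_tower {l : ℕ} (T : TemperedCoverData.{u} l) (hT : IsTempered T.Gtp)
    (htower : ∀ H : Subgroup T.Gtp, IsOpen (H : Set T.Gtp) → ∀ U ∈ 𝓝 (1 : T.Gtp),
      ∃ N : OpenNormalSubgroup T.Gtp, (N : Set T.Gtp) ⊆ U ∧ N.toSubgroup ≤ H ∧
        ∃ (G : Subgroup (T.Gtp ⧸ N.toSubgroup)) (_ : IsFreeGroup G), G.Normal ∧ G.FiniteIndex ∧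
          Finite (IsFreeGroup.Generators G) ∧
          ∃ a ∈ H.map (QuotientGroup.mk' N.toSubgroup) ⊓ G,
            ∃ b ∈ H.map (QuotientGroup.mk' N.toSubgroup) ⊓ G, a * b ≠ b * a) :
    T.Lem217_ii :=
  Lem217_ii_of T corollary_1_6_ii_holds hT htower

/-- **[EtTh] Lemma 2.17 (ii) for open subgroups of finite index** of `Π^tp_C`, for
`T : TemperedCoverData l`, modulo `IsTempered T.Gtp` and the `H`-INDEPENDENT tower fact `htower₀`
(cofinal open normal `N` with `Π^tp_C/N` containing a non-abelian free normal subgroup of finite index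
and finite rank). [cite: MochizukiEtTh2009, Lem 2.17(ii) pp.58–59] -/
theorem normalizer_map_toHat_eq_of_finiteIndex {l : ℕ} (T : TemperedCoverData.{u} l)
    (hT : IsTempered T.Gtp)
    (htower₀ : ∀ U ∈ 𝓝 (1 : T.Gtp), ∃ N : OpenNormalSubgroup T.Gtp, (N : Set T.Gtp) ⊆ U ∧
      ∃ (G : Subgroup (T.Gtp ⧸ N.toSubgroup)) (_ : IsFreeGroup G), G.Normal ∧ G.FiniteIndex ∧
        Finite (IsFreeGroup.Generators G) ∧ ∃ a ∈ G, ∃ b ∈ G, a * b ≠ b * a)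
    (H : Subgroup T.Gtp) (hH : IsOpen (H : Set T.Gtp)) [H.FiniteIndex] :
    Subgroup.normalizer ((H.map T.toHat : Subgroup T.PiC) : Set T.PiC) =
      (Subgroup.normalizer (H : Set T.Gtp)).map T.toHat :=
  normalizer_map_eq_of_isTempered_of_finiteIndex lem217_i hT ⟨T.toHat, T.continuous_toHat⟩
    T.isProfiniteCompletion_toHat H hH htower₀

end ThetaCovers.TemperedCoverData

end Literature.AnabelianGeometry.EtaleTheta
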